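import Summits.NavierStokesRegularity.NavierStokesRegularity.Theorems.EulerZoomLiouvillePowerGaugeEulerLiouvilleNeedleSlices

/-!
# NEEDLE THINNESS: a fast-inflow needle of a finite-energy `C¹` profile has exponentially small in-radius — plate t36d (2/2)
# (P2b of LEAD ns-typeII-p2 g10's needle corollary (N-a) for crux E `PowerGaugeEulerLiouville`, stmt-NavierStokesRegularity-19832)

LANDING PLATE prepared by nsreg-p2 g31 (cell ns-regularity-ideate; DIRECTOR-NS #168 (β) / #180 (4) / #184 (1); LEAD answers
08:24:58Z / 08:52:09Z, KEY 09:02:38Z) for a PROVER seat (`--supports stmt-NavierStokesRegularity-19832 --as helper`); the planner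
lands nothing.  Imports plate t36d 1/2 (`…NeedleSlices`).  Theorems only, 0 sorries.  KERNEL STATEMENTS ONLY — no Euler /
Navier–Stokes content: identifying the hypotheses with the self-similar needle portrait (conjuncts 6–7 of
`EnergySaturation.profileData_of_selfSimilar` with `G ↦ fderiv ℝ V`, `ContDiff`, the fast-inflow cone of `¬ IsTameC2Profile`,
THE ONE STATEMENT's core) is the proof-side file `…NeedleThinCore` (ns-sfl-p1, LEAD KEY 09:02:38Z).

* `needle_inradius_le_radial` (RADIAL-COMPONENT form, cylinder of FREE height — the LEAD's observable, 08:52:09Z (2)/(3)(i)):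
  `V` `C¹` (`HasFDerivAt V (V' y) y` ∀ `y`, `V'` continuous); `(e, e₁, e₂)` orthonormal; axis base point `y₀ = s₀ e`, `0 < s₀`;
  height `0 < h`; `0 < w < δ`; `0 < κ`; a ball `B(0,R) ⊇` cylinder (`0 < R`, `(s₀+h)² + δ² ≤ R²`) with `∫⁻_{B_R} ‖V'‖ₑ² ≤ 𝓔`,
  `∫⁻_{B_R} ‖V‖ₑ² ≤ 𝓐`; BUDGET `32𝓐/(κ²s₀²h) ≤ π(δ² − w²)`; CORE: `−⟪e, V y⟫ ≥ κ s₀` on every transversal disc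
  `discChart (t e) e₁ e₂ (D̄_w)`, `t ∈ (s₀, s₀+h)`.  THEN `w ≤ δ · exp(−π κ² s₀² h / (16 𝓔))`.
* `needle_inradius_le` (FLUX form `⟪y, V y⟫ ≤ −κ₁‖y‖²`, the fast-inflow functional of `IsTameC2Profile`; slab `t ∈ (L, 3L/2)`,
  shell `S_L = {L < ‖y‖ < 2L}`): `0 < w < δ ≤ L`, `0 < κ₂`, `κ₂(L²+δ²) < κ₁L²`, `∫⁻_{S_L}‖V'‖ₑ² ≤ 𝓔`, `∫⁻_{S_L}‖V‖ₑ² ≤ 𝓐`,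
  BUDGET `16𝓐/(κ₂²L³) ≤ π(δ²−w²)`, NEEDLE on every disc `t ∈ (L, 3L/2)`.  THEN
  `w ≤ δ · exp(−π (κ₁L² − κ₂(L²+δ²))² / (64 L 𝓔 + 16 𝓐/L))`.

SCALING / DICTIONARY (numbers for the portrait; `L ≤ s₀ ≤ 2L`, data at radius `3L`: `𝓔 ≤ C (3L)^{1−ρ}` from the E-weight
with `‖y‖^{ρ−1} ≥ (3L)^{ρ−1}`, `𝓐 ≤ c (3L)^{1−2ρ}` from the A-growth): the radial exponent is `≥ (π/16) κ² L² h / (C 3^{1−ρ} L^{1−ρ})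
= c₁ κ² L^{1+ρ} h` — thinness needs a LONG core `h ≫ L^{−1−ρ}`; `h ≍ L` gives `exp(−c κ² L^{2+ρ})` (the (N-a) letter's rate,
`ε(L) ≲ C`), and the budget then reads `δ² ≥ w² + 32c3^{1−2ρ}L^{1−2ρ}/(πκ²L²h) = w² + O(κ⁻²L^{−2−2ρ})` (`δ_L` scale).  A core of
height `h ≤ L^{−1−ρ}` yields NO decay from global bounds (exponent `O(κ²/C)`): the energy near a needle cannot be localised
below the capacity bound itself.  Constants `64, 32, 16, 4` are Chebyshev-quarter artefacts.

PROOF: Tonelli in frame coordinates (`lintegral_slab_le`) + Chebyshev (`exists_good_slice`) pick a slice whose disc `D_δ` has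
energy `< 4𝓔/h` and mass `< 4𝓐/h`; the super-level set `{f > m}` of the observable lies where `|V| ≥ κ s₀/2` (radial) resp.
`|V| ≥ κ₂ L` (flux, `norm_ge_of_inflow`), so Chebyshev bounds its AREA by the budget; `slice_radius_le_radial` / `_flux`
(t36 `core_radius_le_of_area`) close.  WHAT THIS IS NOT: not crux E; the needle/core hypothesis is an INPUT.
[length–area method (Grötzsch–Ahlfors), elementary; concentric special case cf. Mazja1985 §2.2.4 (1) — docstring-only, as in t36]
-/

noncomputable section

set_option linter.dupNamespace false

open MeasureTheory Set Metric Real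
open scoped RealInnerProductSpace ENNReal

namespace Summit.NavierStokesRegularity.NavierStokesRegularity.Theorems.PowerGaugeEulerLiouville.NeedleThinness

open NeedleLogCapacity NeedleDiscChart

/-! ## The needle thinness bounds -/

/-- **Needle thinness (flux form).**  Let `V : ℝ³ → ℝ³` be `C¹` (`HasFDerivAt V (V' y) y` everywhere,
`V'` continuous), `(e, e₁, e₂)` an orthonormal frame, `0 < w < δ ≤ L`, `0 < κ₂`,
`κ₂ (L² + δ²) < κ₁ L²`.  Suppose on the shell `S_L = {L < ‖y‖ < 2L}` the Dirichlet energy is `≤ 𝓔` and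
`∫_{S_L} |V|² ≤ 𝓐`, the budget `16 𝓐 / (κ₂² L³) ≤ π (δ² − w²)` holds, and the NEEDLE hypothesis: every
transversal disc `discChart (t e) e₁ e₂ (D_w)`, `t ∈ (L, 3L/2)`, of radius `w` about the axis `ℝ e` lies
in the fast-inflow set `⟪y, V y⟫ ≤ −κ₁ ‖y‖²`.  Then
`w ≤ δ · exp ( −π (κ₁ L² − κ₂ (L² + δ²))² / (64 L 𝓔 + 16 𝓐 / L) )`.

Proof: Tonelli in frame coordinates + Chebyshev pick a slice `t` whose disc `D_δ` carries energy `< 8𝓔/L`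
and mass `< 8𝓐/L`; on that disc the flux observable `f = −⟪y, V y⟫` is `≥ κ₁ t²` on `D_w`, its super-level
set `{f > κ₂ (t² + δ²)}` lies in the `κ₂`-fast-inflow set where `|V| ≥ κ₂ L`, so has area `≤ 8𝓐/(κ₂² L³)
≤ π(δ² − w²)/2` (Chebyshev); the planar length–area bound `core_radius_le_of_area` (via
`slice_radius_le_flux`, `‖y‖ ≤ 2L` on the disc) gives the claim.  In the self-similar needle portrait
(`L^{ρ−1} ∫_{S_L} ‖∇V‖² =: ε(L) → 0`, `∫_{B_L} |V|² ≤ c L^{1−2ρ}`) this reads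
`w ≤ δ_L · exp(−c₂ κ₁² L^{2+ρ} / ε(L))` with `δ_L² ≍ w² + κ₂⁻² L^{−2−2ρ}`. -/
theorem needle_inradius_le {V : (EuclideanSpace ℝ (Fin 3)) → (EuclideanSpace ℝ (Fin 3))} {V' : (EuclideanSpace ℝ (Fin 3)) → (EuclideanSpace ℝ (Fin 3)) →L[ℝ] (EuclideanSpace ℝ (Fin 3))} (hV : ∀ y, HasFDerivAt V (V' y) y)
    (hV'c : Continuous V') {e e₁ e₂ : (EuclideanSpace ℝ (Fin 3))} (hon : Orthonormal ℝ ![e, e₁, e₂])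
    {L δ w κ₁ κ₂ 𝓔 𝓐 : ℝ} (hL : 0 < L) (hw : 0 < w) (hwδ : w < δ) (hδL : δ ≤ L) (hκ₂ : 0 < κ₂)
    (hsep : κ₂ * (L ^ 2 + δ ^ 2) < κ₁ * L ^ 2) (h𝓔 : 0 < 𝓔) (h𝓐 : 0 < 𝓐)
    (hE : ∫⁻ y in {y : (EuclideanSpace ℝ (Fin 3)) | L < ‖y‖ ∧ ‖y‖ < 2 * L}, ‖V' y‖ₑ ^ 2 ≤ ENNReal.ofReal 𝓔)
    (hA : ∫⁻ y in {y : (EuclideanSpace ℝ (Fin 3)) | L < ‖y‖ ∧ ‖y‖ < 2 * L}, ‖V y‖ₑ ^ 2 ≤ ENNReal.ofReal 𝓐)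
    (hbudget : 16 * 𝓐 / (κ₂ ^ 2 * L ^ 3) ≤ π * (δ ^ 2 - w ^ 2))
    (hneedle : ∀ t ∈ Ioo L (3 * L / 2), ∀ z : ℂ, ‖z‖ ≤ w →
      ⟪discChart (t • e) e₁ e₂ z, V (discChart (t • e) e₁ e₂ z)⟫ ≤ -(κ₁ * ‖discChart (t • e) e₁ e₂ z‖ ^ 2)) :
    w ≤ δ * Real.exp (-(π * (κ₁ * L ^ 2 - κ₂ * (L ^ 2 + δ ^ 2)) ^ 2 / (64 * L * 𝓔 + 16 * 𝓐 / L))) := by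
  have he := norm_frame₀ hon
  have h₁ := norm_frame₁ hon
  have h₂ := norm_frame₂ hon
  have he1 := inner_frame₀₁ hon
  have he2 := inner_frame₀₂ hon
  have h12 := inner_frame₁₂ hon
  have hVc : Continuous V := continuous_iff_continuousAt.2 fun y => (hV y).continuousAt
  have hδ : 0 < δ := hw.trans hwδ
  have hL2 : 0 < L ^ 2 := by positivity
  have hκ₁₂ : κ₂ < κ₁ := by
    by_contra hcon
    push Not at hcon
    have h1 : κ₁ * L ^ 2 ≤ κ₂ * L ^ 2 := mul_le_mul_of_nonneg_right hcon hL2.le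
    have h2 : 0 ≤ κ₂ * δ ^ 2 := mul_nonneg hκ₂.le (sq_nonneg δ)
    linarith
  have hκ₁ : 0 < κ₁ := hκ₂.trans hκ₁₂
  -- geometry of the slab
  have hnorm : ∀ (t : ℝ) (z : ℂ), ‖discChart (t • e) e₁ e₂ z‖ ^ 2 = t ^ 2 + ‖z‖ ^ 2 := by
    intro t z
    have hc1 : ⟪t • e, e₁⟫ = 0 := by rw [real_inner_smul_left, he1, mul_zero]
    have hc2 : ⟪t • e, e₂⟫ = 0 := by rw [real_inner_smul_left, he2, mul_zero]
    rw [norm_discChart_sq h₁ h₂ h12 hc1 hc2, norm_smul, he, mul_one, Real.norm_eq_abs, sq_abs]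
  set S : Set (EuclideanSpace ℝ (Fin 3)) := {y : (EuclideanSpace ℝ (Fin 3)) | L < ‖y‖ ∧ ‖y‖ < 2 * L} with hSdef
  have hSm : MeasurableSet S :=
    ((isOpen_lt continuous_const continuous_norm).inter
      (isOpen_lt continuous_norm continuous_const)).measurableSet
  have hmaps : ∀ t ∈ Ioo L (3 * L / 2), ∀ z ∈ ball (0 : ℂ) δ, discChart (t • e) e₁ e₂ z ∈ S := by
    intro t ht z hz
    rw [mem_ball_zero_iff] at hz
    have hn := hnorm t z
    have ht1 : L < t := ht.1
    have ht2 : t < 3 * L / 2 := ht.2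
    have hy0 : 0 ≤ ‖discChart (t • e) e₁ e₂ z‖ := norm_nonneg _
    have hz0 : 0 ≤ ‖z‖ := norm_nonneg _
    have ht0 : 0 < t := hL.trans ht1
    have hLt : L ^ 2 < t ^ 2 := pow_lt_pow_left₀ ht1 hL.le two_ne_zero
    have ht3 : t ^ 2 < (3 * L / 2) ^ 2 := pow_lt_pow_left₀ ht2 ht0.le two_ne_zero
    have hzδ : ‖z‖ ^ 2 < δ ^ 2 := pow_lt_pow_left₀ hz hz0 two_ne_zero
    have hδL2 : δ ^ 2 ≤ L ^ 2 := pow_le_pow_left₀ hδ.le hδL 2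
    refine ⟨?_, ?_⟩
    · have h' : L ^ 2 < ‖discChart (t • e) e₁ e₂ z‖ ^ 2 := by
        rw [hn]; linarith [sq_nonneg ‖z‖]
      exact lt_of_pow_lt_pow_left₀ 2 hy0 h'
    · have h' : ‖discChart (t • e) e₁ e₂ z‖ ^ 2 < (2 * L) ^ 2 := by
        rw [hn]; nlinarith
      exact lt_of_pow_lt_pow_left₀ 2 (by positivity) h'
  -- slice energies and the good slice
  have hcont := continuous_discChart₂ e e₁ e₂
  have hgEm : Measurable fun y : (EuclideanSpace ℝ (Fin 3)) => ‖V' y‖ₑ ^ 2 := hV'c.measurable.enorm.pow_const 2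
  have hgAm : Measurable fun y : (EuclideanSpace ℝ (Fin 3)) => ‖V y‖ₑ ^ 2 := hVc.measurable.enorm.pow_const 2
  have hF : Measurable fun t : ℝ => ∫⁻ z in ball (0 : ℂ) δ, ‖V' (discChart (t • e) e₁ e₂ z)‖ₑ ^ 2 :=
    Measurable.lintegral_prod_right' (f := fun p : ℝ × ℂ => ‖V' (discChart (p.1 • e) e₁ e₂ p.2)‖ₑ ^ 2)
      (hgEm.comp hcont.measurable)
  have hG : Measurable fun t : ℝ => ∫⁻ z in ball (0 : ℂ) δ, ‖V (discChart (t • e) e₁ e₂ z)‖ₑ ^ 2 :=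
    Measurable.lintegral_prod_right' (f := fun p : ℝ × ℂ => ‖V (discChart (p.1 • e) e₁ e₂ p.2)‖ₑ ^ 2)
      (hgAm.comp hcont.measurable)
  have hIF : ∫⁻ t in Ioo L (3 * L / 2), ∫⁻ z in ball (0 : ℂ) δ, ‖V' (discChart (t • e) e₁ e₂ z)‖ₑ ^ 2 ≤
      ENNReal.ofReal 𝓔 :=
    (lintegral_slab_le hon hgEm measurableSet_Ioo measurableSet_ball hSm hmaps).trans hE
  have hIG : ∫⁻ t in Ioo L (3 * L / 2), ∫⁻ z in ball (0 : ℂ) δ, ‖V (discChart (t • e) e₁ e₂ z)‖ₑ ^ 2 ≤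
      ENNReal.ofReal 𝓐 :=
    (lintegral_slab_le hon hgAm measurableSet_Ioo measurableSet_ball hSm hmaps).trans hA
  have hL32 : L < 3 * L / 2 := by linarith
  obtain ⟨t, htI, hFt, hGt⟩ := exists_good_slice hF hG hL32 h𝓔 h𝓐 hIF hIG
  have h8 : ∀ X : ℝ, 4 * X / (3 * L / 2 - L) = 8 * X / L := fun X => by
    rw [show 3 * L / 2 - L = L / 2 by ring, div_div_eq_mul_div]; ring
  rw [h8] at hFt hGt
  have ht1 : L < t := htI.1
  have ht0 : 0 < t := hL.trans ht1
  have hLt : L ^ 2 ≤ t ^ 2 := (pow_lt_pow_left₀ ht1 hL.le two_ne_zero).le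
  have hx : (κ₁ - κ₂) * L ^ 2 ≤ (κ₁ - κ₂) * t ^ 2 := mul_le_mul_of_nonneg_left hLt (sub_nonneg.2 hκ₁₂.le)
  -- real forms of the slice energies
  have h8𝓔 : 0 < 8 * 𝓔 / L := by positivity
  have h8𝓐 : 0 < 8 * 𝓐 / L := by positivity
  have hEV' : ∫ z in ball (0 : ℂ) δ, ‖V' (discChart (t • e) e₁ e₂ z)‖ ^ 2 < 8 * 𝓔 / L :=
    integral_sq_lt_of_lintegral_lt (h := fun z => V' (discChart (t • e) e₁ e₂ z))
      (hV'c.comp (continuous_discChart _ _ _)) h8𝓔 hFt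
  have hEV : ∫ z in ball (0 : ℂ) δ, ‖V (discChart (t • e) e₁ e₂ z)‖ ^ 2 < 8 * 𝓐 / L :=
    integral_sq_lt_of_lintegral_lt (h := fun z => V (discChart (t • e) e₁ e₂ z))
      (hVc.comp (continuous_discChart _ _ _)) h8𝓐 hGt
  -- slice data
  have hR : ∀ z ∈ ball (0 : ℂ) δ, ‖discChart (t • e) e₁ e₂ z‖ ≤ 2 * L :=
    fun z hz => (hmaps t htI z hz).2.le
  have hM : ∀ z : ℂ, ‖z‖ ≤ w →
      κ₁ * t ^ 2 ≤ -⟪discChart (t • e) e₁ e₂ z, V (discChart (t • e) e₁ e₂ z)⟫ := by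
    intro z hz
    have h := hneedle t htI z hz
    have hn := hnorm t z
    have h2 : t ^ 2 ≤ ‖discChart (t • e) e₁ e₂ z‖ ^ 2 := by
      rw [hn]; exact le_add_of_nonneg_right (sq_nonneg _)
    have h3 : κ₁ * t ^ 2 ≤ κ₁ * ‖discChart (t • e) e₁ e₂ z‖ ^ 2 := mul_le_mul_of_nonneg_left h2 hκ₁.le
    linarith
  have hmM : κ₂ * (t ^ 2 + δ ^ 2) < κ₁ * t ^ 2 := by linarith
  -- area of the super-level set on the slice
  set A : Set ℂ := {z : ℂ | ‖z‖ < δ ∧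
      κ₂ * (t ^ 2 + δ ^ 2) < -⟪discChart (t • e) e₁ e₂ z, V (discChart (t • e) e₁ e₂ z)⟫} with hAdef
  have hfc : Continuous fun z : ℂ => -⟪discChart (t • e) e₁ e₂ z, V (discChart (t • e) e₁ e₂ z)⟫ :=
    ((continuous_discChart _ _ _).inner (hVc.comp (continuous_discChart _ _ _))).neg
  have hAm : MeasurableSet A :=
    ((isOpen_lt continuous_norm continuous_const).inter (isOpen_lt continuous_const hfc)).measurableSet
  have hAball : A ⊆ ball (0 : ℂ) δ := fun z hz => mem_ball_zero_iff.2 hz.1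
  have hlow : ∀ z ∈ A, ENNReal.ofReal ((κ₂ * L) ^ 2) ≤ ‖V (discChart (t • e) e₁ e₂ z)‖ₑ ^ 2 := by
    intro z hz
    have hn := hnorm t z
    have hzδ : ‖z‖ < δ := hz.1
    have hy2 : ‖discChart (t • e) e₁ e₂ z‖ ^ 2 < t ^ 2 + δ ^ 2 := by
      rw [hn]; linarith [pow_lt_pow_left₀ hzδ (norm_nonneg z) two_ne_zero]
    have hfast : ⟪discChart (t • e) e₁ e₂ z, V (discChart (t • e) e₁ e₂ z)⟫ <
        -(κ₂ * ‖discChart (t • e) e₁ e₂ z‖ ^ 2) := by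
      have h4 := hz.2
      have h5 := mul_lt_mul_of_pos_left hy2 hκ₂
      linarith
    have hsp := norm_ge_of_inflow hfast
    have hyL : L < ‖discChart (t • e) e₁ e₂ z‖ := (hmaps t htI z (hAball hz)).1
    have hVL : κ₂ * L ≤ ‖V (discChart (t • e) e₁ e₂ z)‖ :=
      (mul_le_mul_of_nonneg_left hyL.le hκ₂.le).trans hsp
    rw [← ofReal_norm, ← ENNReal.ofReal_pow (norm_nonneg _)]
    exact ENNReal.ofReal_le_ofReal (pow_le_pow_left₀ (by positivity) hVL 2)
  have harea : volume A ≤ ENNReal.ofReal (π * (δ ^ 2 - w ^ 2) / 2) := by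
    have hcA : ENNReal.ofReal ((κ₂ * L) ^ 2) * volume A ≤ ENNReal.ofReal (8 * 𝓐 / L) := by
      calc ENNReal.ofReal ((κ₂ * L) ^ 2) * volume A = ∫⁻ _ in A, ENNReal.ofReal ((κ₂ * L) ^ 2) :=
            (setLIntegral_const A _).symm
        _ ≤ ∫⁻ z in A, ‖V (discChart (t • e) e₁ e₂ z)‖ₑ ^ 2 := setLIntegral_mono' hAm hlow
        _ ≤ ∫⁻ z in ball (0 : ℂ) δ, ‖V (discChart (t • e) e₁ e₂ z)‖ₑ ^ 2 := lintegral_mono_set hAball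
        _ ≤ ENNReal.ofReal (8 * 𝓐 / L) := hGt.le
    have hk : ENNReal.ofReal ((κ₂ * L) ^ 2) ≠ 0 := (ENNReal.ofReal_pos.2 (by positivity)).ne'
    have hk' : ENNReal.ofReal ((κ₂ * L) ^ 2) ≠ ∞ := ENNReal.ofReal_ne_top
    calc volume A ≤ ENNReal.ofReal (8 * 𝓐 / L) / ENNReal.ofReal ((κ₂ * L) ^ 2) := by
          rw [ENNReal.le_div_iff_mul_le (Or.inl hk) (Or.inl hk'), mul_comm]; exact hcA
      _ = ENNReal.ofReal (8 * 𝓐 / L / (κ₂ * L) ^ 2) := (ENNReal.ofReal_div_of_pos (by positivity)).symm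
      _ ≤ ENNReal.ofReal (π * (δ ^ 2 - w ^ 2) / 2) := by
          apply ENNReal.ofReal_le_ofReal
          have h16 : 8 * 𝓐 / L / (κ₂ * L) ^ 2 = (16 * 𝓐 / (κ₂ ^ 2 * L ^ 3)) / 2 := by
            field_simp
            ring
          rw [h16]
          linarith
  -- the planar bound on the good slice
  have hslice := slice_radius_le_flux hV hV'c h₁ h₂ h12 (c := t • e) hw hwδ hR hM hmM harea hEV.le hEV'.le
  -- compare exponents
  have hD : 2 * (8 * 𝓐 / L) + 2 * (2 * L) ^ 2 * (8 * 𝓔 / L) = 64 * L * 𝓔 + 16 * 𝓐 / L := by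
    field_simp
    ring
  have hDpos : 0 < 64 * L * 𝓔 + 16 * 𝓐 / L := by positivity
  have hΔ : κ₁ * L ^ 2 - κ₂ * (L ^ 2 + δ ^ 2) ≤ κ₁ * t ^ 2 - κ₂ * (t ^ 2 + δ ^ 2) := by linarith
  have hΔ0 : 0 ≤ κ₁ * L ^ 2 - κ₂ * (L ^ 2 + δ ^ 2) := by linarith
  rw [hD] at hslice
  refine hslice.trans (mul_le_mul_of_nonneg_left (Real.exp_le_exp.2 ?_) hδ.le)
  rw [neg_le_neg_iff]
  exact div_le_div_of_nonneg_right (mul_le_mul_of_nonneg_left (pow_le_pow_left₀ hΔ0 hΔ 2) Real.pi_pos.le)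
    hDpos.le

/-- **Needle thinness (radial-component form, cylinder of free height; the LEAD's observable).**
`V : ℝ³ → ℝ³` `C¹` (`HasFDerivAt V (V' y) y` everywhere, `V'` continuous); `(e, e₁, e₂)` orthonormal; axis base point
`y₀ = s₀ e`, `0 < s₀`; height `0 < h`; `0 < w < δ`; threshold `0 < κ`; a ball `B(0, R)` containing the cylinder
(`0 < R`, `(s₀ + h)² + δ² ≤ R²`) on which `∫ ‖∇V‖² ≤ 𝓔` and `∫ |V|² ≤ 𝓐` (as `lintegral`s of `‖·‖ₑ²`); BUDGET
`32 𝓐 / (κ² s₀² h) ≤ π (δ² − w²)`; CORE: on every transversal disc `discChart (t e) e₁ e₂ (D̄_w)`, `t ∈ (s₀, s₀ + h)`,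
the radial component satisfies `−⟪e, V y⟫ ≥ κ s₀`.  THEN  `w ≤ δ · exp(−π κ² s₀² h / (16 𝓔))`.
SCALING (for the portrait, with `s₀ ≍ L`, `𝓔 ≲ C L^{1−ρ}`, `𝓐 ≲ c L^{1−2ρ}` from the profile data at radius `3L`):
exponent `≍ κ² L^{1+ρ} h / C` — super-exponential thinness needs a LONG core, `h ≫ L^{−1−ρ}`; `h ≍ L` gives
`exp(−c κ² L^{2+ρ})` and the budget then allows `δ² = w² + O(κ⁻² L^{−2−2ρ})`. -/
theorem needle_inradius_le_radial {V : (EuclideanSpace ℝ (Fin 3)) → (EuclideanSpace ℝ (Fin 3))}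
    {V' : (EuclideanSpace ℝ (Fin 3)) → (EuclideanSpace ℝ (Fin 3)) →L[ℝ] (EuclideanSpace ℝ (Fin 3))}
    (hV : ∀ y, HasFDerivAt V (V' y) y) (hV'c : Continuous V') {e e₁ e₂ : (EuclideanSpace ℝ (Fin 3))}
    (hon : Orthonormal ℝ ![e, e₁, e₂]) {s₀ h δ w κ R 𝓔 𝓐 : ℝ} (hs₀ : 0 < s₀) (hh : 0 < h) (hw : 0 < w)
    (hwδ : w < δ) (hκ : 0 < κ) (hR0 : 0 < R) (hR : (s₀ + h) ^ 2 + δ ^ 2 ≤ R ^ 2) (h𝓔 : 0 < 𝓔) (h𝓐 : 0 < 𝓐)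
    (hE : ∫⁻ y in ball (0 : EuclideanSpace ℝ (Fin 3)) R, ‖V' y‖ₑ ^ 2 ≤ ENNReal.ofReal 𝓔)
    (hA : ∫⁻ y in ball (0 : EuclideanSpace ℝ (Fin 3)) R, ‖V y‖ₑ ^ 2 ≤ ENNReal.ofReal 𝓐)
    (hbudget : 32 * 𝓐 / (κ ^ 2 * s₀ ^ 2 * h) ≤ π * (δ ^ 2 - w ^ 2))
    (hcore : ∀ t ∈ Ioo s₀ (s₀ + h), ∀ z : ℂ, ‖z‖ ≤ w → κ * s₀ ≤ -⟪e, V (discChart (t • e) e₁ e₂ z)⟫) :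
    w ≤ δ * Real.exp (-(π * (κ * s₀) ^ 2 * h / (16 * 𝓔))) := by
  have he := norm_frame₀ hon
  have h₁ := norm_frame₁ hon
  have h₂ := norm_frame₂ hon
  have he1 := inner_frame₀₁ hon
  have he2 := inner_frame₀₂ hon
  have h12 := inner_frame₁₂ hon
  have hVc : Continuous V := continuous_iff_continuousAt.2 fun y => (hV y).continuousAt
  have hδ : 0 < δ := hw.trans hwδ
  have hnorm : ∀ (t : ℝ) (z : ℂ), ‖discChart (t • e) e₁ e₂ z‖ ^ 2 = t ^ 2 + ‖z‖ ^ 2 := by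
    intro t z
    have hc1 : ⟪t • e, e₁⟫ = 0 := by rw [real_inner_smul_left, he1, mul_zero]
    have hc2 : ⟪t • e, e₂⟫ = 0 := by rw [real_inner_smul_left, he2, mul_zero]
    rw [norm_discChart_sq h₁ h₂ h12 hc1 hc2, norm_smul, he, mul_one, Real.norm_eq_abs, sq_abs]
  have hmaps : ∀ t ∈ Ioo s₀ (s₀ + h), ∀ z ∈ ball (0 : ℂ) δ,
      discChart (t • e) e₁ e₂ z ∈ ball (0 : EuclideanSpace ℝ (Fin 3)) R := by
    intro t ht z hz
    rw [mem_ball_zero_iff] at hz ⊢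
    have ht0 : 0 < t := hs₀.trans ht.1
    have ht2 : t ^ 2 < (s₀ + h) ^ 2 := pow_lt_pow_left₀ ht.2 ht0.le two_ne_zero
    have hzδ : ‖z‖ ^ 2 < δ ^ 2 := pow_lt_pow_left₀ hz (norm_nonneg z) two_ne_zero
    have h' : ‖discChart (t • e) e₁ e₂ z‖ ^ 2 < R ^ 2 := by rw [hnorm]; linarith
    exact lt_of_pow_lt_pow_left₀ 2 hR0.le h'
  -- slice energies, Tonelli, good slice
  have hcont := continuous_discChart₂ e e₁ e₂
  have hgEm : Measurable fun y : EuclideanSpace ℝ (Fin 3) => ‖V' y‖ₑ ^ 2 := hV'c.measurable.enorm.pow_const 2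
  have hgAm : Measurable fun y : EuclideanSpace ℝ (Fin 3) => ‖V y‖ₑ ^ 2 := hVc.measurable.enorm.pow_const 2
  have hF : Measurable fun t : ℝ => ∫⁻ z in ball (0 : ℂ) δ, ‖V' (discChart (t • e) e₁ e₂ z)‖ₑ ^ 2 :=
    Measurable.lintegral_prod_right'
      (f := fun p : ℝ × ℂ => ‖V' (discChart (p.1 • e) e₁ e₂ p.2)‖ₑ ^ 2) (hgEm.comp hcont.measurable)
  have hG : Measurable fun t : ℝ => ∫⁻ z in ball (0 : ℂ) δ, ‖V (discChart (t • e) e₁ e₂ z)‖ₑ ^ 2 :=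
    Measurable.lintegral_prod_right'
      (f := fun p : ℝ × ℂ => ‖V (discChart (p.1 • e) e₁ e₂ p.2)‖ₑ ^ 2) (hgAm.comp hcont.measurable)
  have hIF := (lintegral_slab_le hon hgEm measurableSet_Ioo measurableSet_ball measurableSet_ball hmaps).trans hE
  have hIG := (lintegral_slab_le hon hgAm measurableSet_Ioo measurableSet_ball measurableSet_ball hmaps).trans hA
  have hab : s₀ < s₀ + h := by linarith
  obtain ⟨t, htI, hFt, hGt⟩ := exists_good_slice hF hG hab h𝓔 h𝓐 hIF hIG
  rw [add_sub_cancel_left] at hFt hGt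
  have h4𝓔 : 0 < 4 * 𝓔 / h := by positivity
  have h4𝓐 : 0 < 4 * 𝓐 / h := by positivity
  have hEV' : ∫ z in ball (0 : ℂ) δ, ‖V' (discChart (t • e) e₁ e₂ z)‖ ^ 2 < 4 * 𝓔 / h :=
    integral_sq_lt_of_lintegral_lt (h := fun z => V' (discChart (t • e) e₁ e₂ z))
      (hV'c.comp (continuous_discChart _ _ _)) h4𝓔 hFt
  -- slice data for the radial observable
  have hM : ∀ z : ℂ, ‖z‖ ≤ w → κ * s₀ ≤ -⟪e, V (discChart (t • e) e₁ e₂ z)⟫ := hcore t htI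
  have hmM : κ * s₀ / 2 < κ * s₀ := by linarith [mul_pos hκ hs₀]
  set A : Set ℂ := {z : ℂ | ‖z‖ < δ ∧ κ * s₀ / 2 < -⟪e, V (discChart (t • e) e₁ e₂ z)⟫} with hAdef
  have hfc : Continuous fun z : ℂ => -⟪e, V (discChart (t • e) e₁ e₂ z)⟫ :=
    (continuous_const.inner (hVc.comp (continuous_discChart _ _ _))).neg
  have hAm : MeasurableSet A :=
    ((isOpen_lt continuous_norm continuous_const).inter (isOpen_lt continuous_const hfc)).measurableSet
  have hAball : A ⊆ ball (0 : ℂ) δ := fun z hz => mem_ball_zero_iff.2 hz.1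
  have hlow : ∀ z ∈ A, ENNReal.ofReal ((κ * s₀ / 2) ^ 2) ≤ ‖V (discChart (t • e) e₁ e₂ z)‖ₑ ^ 2 := by
    intro z hz
    have hcs : |⟪e, V (discChart (t • e) e₁ e₂ z)⟫| ≤ ‖e‖ * ‖V (discChart (t • e) e₁ e₂ z)‖ :=
      abs_real_inner_le_norm _ _
    rw [he, one_mul] at hcs
    have hVk : κ * s₀ / 2 ≤ ‖V (discChart (t • e) e₁ e₂ z)‖ := by
      have h5 := hz.2
      have h6 := neg_le_abs ⟪e, V (discChart (t • e) e₁ e₂ z)⟫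
      linarith
    rw [← ofReal_norm, ← ENNReal.ofReal_pow (norm_nonneg _)]
    exact ENNReal.ofReal_le_ofReal (pow_le_pow_left₀ (by positivity) hVk 2)
  have harea : volume A ≤ ENNReal.ofReal (π * (δ ^ 2 - w ^ 2) / 2) := by
    have hcA : ENNReal.ofReal ((κ * s₀ / 2) ^ 2) * volume A ≤ ENNReal.ofReal (4 * 𝓐 / h) := by
      calc ENNReal.ofReal ((κ * s₀ / 2) ^ 2) * volume A = ∫⁻ _ in A, ENNReal.ofReal ((κ * s₀ / 2) ^ 2) :=
            (setLIntegral_const A _).symm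
        _ ≤ ∫⁻ z in A, ‖V (discChart (t • e) e₁ e₂ z)‖ₑ ^ 2 := setLIntegral_mono' hAm hlow
        _ ≤ ∫⁻ z in ball (0 : ℂ) δ, ‖V (discChart (t • e) e₁ e₂ z)‖ₑ ^ 2 := lintegral_mono_set hAball
        _ ≤ ENNReal.ofReal (4 * 𝓐 / h) := hGt.le
    have hk : ENNReal.ofReal ((κ * s₀ / 2) ^ 2) ≠ 0 := (ENNReal.ofReal_pos.2 (by positivity)).ne'
    have hk' : ENNReal.ofReal ((κ * s₀ / 2) ^ 2) ≠ ∞ := ENNReal.ofReal_ne_top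
    calc volume A ≤ ENNReal.ofReal (4 * 𝓐 / h) / ENNReal.ofReal ((κ * s₀ / 2) ^ 2) := by
          rw [ENNReal.le_div_iff_mul_le (Or.inl hk) (Or.inl hk'), mul_comm]; exact hcA
      _ = ENNReal.ofReal (4 * 𝓐 / h / (κ * s₀ / 2) ^ 2) := (ENNReal.ofReal_div_of_pos (by positivity)).symm
      _ ≤ ENNReal.ofReal (π * (δ ^ 2 - w ^ 2) / 2) := by
          apply ENNReal.ofReal_le_ofReal
          have h16 : 4 * 𝓐 / h / (κ * s₀ / 2) ^ 2 = (32 * 𝓐 / (κ ^ 2 * s₀ ^ 2 * h)) / 2 := by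
            field_simp
            ring
          rw [h16]
          linarith
  have hslice := slice_radius_le_radial hV hV'c (c := t • e) he h₁ h₂ h12 hw hwδ hM hmM harea hEV'.le
  have hexp : π * (κ * s₀ - κ * s₀ / 2) ^ 2 / (4 * 𝓔 / h) = π * (κ * s₀) ^ 2 * h / (16 * 𝓔) := by
    field_simp
    ring
  rw [hexp] at hslice
  exact hslice

end Summit.NavierStokesRegularity.NavierStokesRegularity.Theorems.PowerGaugeEulerLiouville.NeedleThinness
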